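import Summits.CriticalPhenomena.PercolationContinuityZ3.Theorems.PercNearOneGluingNoHeavyQuantTwoBlobZeroFlow
import Summits.CriticalPhenomena.PercolationContinuityZ3.Theorems.PercNearOneGluingNoHeavyQuantLightLightTwoBlobCellsO
import HarnessLib

/-!
# QUANT lane R8, T-DEC: the LIGHT–LIGHT two-blob law — part 3a: sub-case O (only atom `0` low), one lemma per cell + the case split

builds on p205010 (kernel theorem, internal audit signed; external expert review pending)

Support file (`--supports stmt-CriticalPhenomena-4575`), QUANT lane typer seat prim-quant-stmt (gen 23), rung R8 of
`run/shared/lean/prim/quant/LADDER.md`.  Theorems only, standard axioms, no sorries.  `dec_O_<sb><sa>` (9 cells: status of `(0,b)`, `(0,a)` ∈ {inc, H, L}) apply\n`LawDec.twoBlob_decAtT_of_capacity` (`…QuantTwoBlobZeroFlow`) with the closed-form capacities `C_b`, `C_a` of the mids (`C·usage = mass`\nexactly) and the capacity cell `cap_O_*` (`…QuantLightLightTwoBlobCellsO`); `lightLightTwoBlob_decAtT_zeroK` is the case split (κ-form:\ngates written `x² + (1−x)κᵢ`).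

[this work]; DEC rules ARCH-TREES-G49 §2.2 / DEC-TAMP-G50 §3.1, flow normal form `…QuantLawDecFlows` (this lane).  The gluing rows served
[cite: KozmaNitzan2024, Conjecture 3 (p. 15)]; product measure [cite: Grimmett1999, §1.3 p. 10].
-/

noncomputable section

namespace Summit.CriticalPhenomena.PercolationContinuityZ3.Theorems

namespace Quant

open Finset

/-- the two-blob law `(1−u)(1−v)δ₀ + u(1−v)δ_a + (1−u)vδ_b + uvδ_{a+b}` evaluated at `h` (as in `…QuantBlobDecTwoLawParts`) -/
local notation3 "LAW2[" a ", " u ", " b ", " v ", " h "]" =>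
  (1 - (u : ℝ)) * (1 - (v : ℝ)) * (if (h : ℕ) = 0 then (1 : ℝ) else 0)
    + (u : ℝ) * (1 - (v : ℝ)) * (if (h : ℕ) = (a : ℕ) then (1 : ℝ) else 0)
    + (1 - (u : ℝ)) * (v : ℝ) * (if (h : ℕ) = (b : ℕ) then (1 : ℝ) else 0)
    + (u : ℝ) * (v : ℝ) * (if (h : ℕ) = (a : ℕ) + (b : ℕ) then (1 : ℝ) else 0)

namespace LawDec

/-! ### Sub-case O, one lemma per cell -/

/-- light–light law, sub-case O, cell (0,b) inc / (0,a) inc. [this work] -/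
theorem dec_O_incinc (x κ₁ κ₂ : ℝ) (a b j'' : ℕ) (hx0 : 0 < x) (hx1 : x < 1) (hk0 : 0 < κ₁) (hkx : κ₁ < x) (hk20 : 0 < κ₂) (hk2x : κ₂ < x)
    (ha : 1 ≤ a) (hb : 1 ≤ b) (hj : a + b ≤ j'')
    (h2b : ((b : ℝ) * κ₁ + (a : ℝ) * κ₂) ≤ 2 * (b : ℝ)) (h2a : ((b : ℝ) * κ₁ + (a : ℝ) * κ₂) ≤ 2 * (a : ℝ)) (hTb : (b : ℝ) ≤ ((b : ℝ) * κ₁ + (a : ℝ) * κ₂)) (hTa : (a : ℝ) ≤ ((b : ℝ) * κ₁ + (a : ℝ) * κ₂)) :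
    DECAtT x ((b : ℝ) * κ₁ + (a : ℝ) * κ₂) j'' (b + a) (fun h => LAW2[b, (x ^ 2 + (1 - x) * κ₁), a, (x ^ 2 + (1 - x) * κ₂), h]) := by
  have ha0 : (0 : ℝ) < (a : ℝ) := by exact_mod_cast Nat.lt_of_lt_of_le Nat.zero_lt_one ha
  have hb0 : (0 : ℝ) < (b : ℝ) := by exact_mod_cast Nat.lt_of_lt_of_le Nat.zero_lt_one hb
  have hu0 : 0 ≤ x ^ 2 + (1 - x) * κ₁ := by nlinarith [mul_pos (sub_pos.2 hx1) hk0]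
  have hu1 : x ^ 2 + (1 - x) * κ₁ ≤ 1 := by nlinarith [mul_lt_mul_of_pos_left hkx (sub_pos.2 hx1)]
  have hux : x ^ 2 + (1 - x) * κ₁ < x := by nlinarith [mul_lt_mul_of_pos_left hkx (sub_pos.2 hx1)]
  have hv0 : 0 ≤ x ^ 2 + (1 - x) * κ₂ := by nlinarith [mul_pos (sub_pos.2 hx1) hk20]
  have hv1 : x ^ 2 + (1 - x) * κ₂ ≤ 1 := by nlinarith [mul_lt_mul_of_pos_left hk2x (sub_pos.2 hx1)]
  have hvx : x ^ 2 + (1 - x) * κ₂ < x := by nlinarith [mul_lt_mul_of_pos_left hk2x (sub_pos.2 hx1)]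
  have hT0 : 0 < (b : ℝ) * κ₁ + (a : ℝ) * κ₂ := by nlinarith [mul_pos hb0 hk0, mul_pos ha0 hk20]
  have hsT : (b : ℝ) * κ₁ + (a : ℝ) * κ₂ < (b : ℝ) + (a : ℝ) := by
    nlinarith [mul_pos hb0 (sub_pos.2 (hkx.trans hx1)), mul_pos ha0 (sub_pos.2 (hk2x.trans hx1))]
  have hbaj : b + a ≤ j'' := by omega
  exact twoBlob_decAtT_of_capacity x (x ^ 2 + (1 - x) * κ₁) (x ^ 2 + (1 - x) * κ₂) ((b : ℝ) * κ₁ + (a : ℝ) * κ₂) (0) (0) b a j'' hx0 hx1 hu0 hu1 hv0 hv1 hb ha hbaj hT0 h2b h2a hsT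
    le_rfl le_rfl (Or.inl rfl) (Or.inl rfl)
    (cap_O_incinc x κ₁ κ₂ a b j'' hx0 hx1 hk0 hkx hk20 hk2x ha hb hj h2b h2a hTb hTa)

/-- light–light law, sub-case O, cell (0,b) inc / (0,a) H. [this work] -/
theorem dec_O_incH (x κ₁ κ₂ : ℝ) (a b j'' : ℕ) (hx0 : 0 < x) (hx1 : x < 1) (hk0 : 0 < κ₁) (hkx : κ₁ < x) (hk20 : 0 < κ₂) (hk2x : κ₂ < x)
    (ha : 1 ≤ a) (hb : 1 ≤ b) (hj : a + b ≤ j'')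
    (h2b : ((b : ℝ) * κ₁ + (a : ℝ) * κ₂) ≤ 2 * (b : ℝ)) (h2a : ((b : ℝ) * κ₁ + (a : ℝ) * κ₂) ≤ 2 * (a : ℝ)) (hTb : (b : ℝ) ≤ ((b : ℝ) * κ₁ + (a : ℝ) * κ₂)) (hTa : ((b : ℝ) * κ₁ + (a : ℝ) * κ₂) < (a : ℝ)) (hHa : x * (a : ℝ) ≤ ((b : ℝ) * κ₁ + (a : ℝ) * κ₂)) :
    DECAtT x ((b : ℝ) * κ₁ + (a : ℝ) * κ₂) j'' (b + a) (fun h => LAW2[b, (x ^ 2 + (1 - x) * κ₁), a, (x ^ 2 + (1 - x) * κ₂), h]) := by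
  have ha0 : (0 : ℝ) < (a : ℝ) := by exact_mod_cast Nat.lt_of_lt_of_le Nat.zero_lt_one ha
  have hb0 : (0 : ℝ) < (b : ℝ) := by exact_mod_cast Nat.lt_of_lt_of_le Nat.zero_lt_one hb
  have hu0 : 0 ≤ x ^ 2 + (1 - x) * κ₁ := by nlinarith [mul_pos (sub_pos.2 hx1) hk0]
  have hu1 : x ^ 2 + (1 - x) * κ₁ ≤ 1 := by nlinarith [mul_lt_mul_of_pos_left hkx (sub_pos.2 hx1)]
  have hux : x ^ 2 + (1 - x) * κ₁ < x := by nlinarith [mul_lt_mul_of_pos_left hkx (sub_pos.2 hx1)]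
  have hv0 : 0 ≤ x ^ 2 + (1 - x) * κ₂ := by nlinarith [mul_pos (sub_pos.2 hx1) hk20]
  have hv1 : x ^ 2 + (1 - x) * κ₂ ≤ 1 := by nlinarith [mul_lt_mul_of_pos_left hk2x (sub_pos.2 hx1)]
  have hvx : x ^ 2 + (1 - x) * κ₂ < x := by nlinarith [mul_lt_mul_of_pos_left hk2x (sub_pos.2 hx1)]
  have hT0 : 0 < (b : ℝ) * κ₁ + (a : ℝ) * κ₂ := by nlinarith [mul_pos hb0 hk0, mul_pos ha0 hk20]
  have hsT : (b : ℝ) * κ₁ + (a : ℝ) * κ₂ < (b : ℝ) + (a : ℝ) := by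
    nlinarith [mul_pos hb0 (sub_pos.2 (hkx.trans hx1)), mul_pos ha0 (sub_pos.2 (hk2x.trans hx1))]
  have hbaj : b + a ≤ j'' := by omega
  have hCa0 : 0 ≤ ((1 - (x ^ 2 + (1 - x) * κ₁)) * (x ^ 2 + (1 - x) * κ₂)) * ((a : ℝ) - ((b : ℝ) * κ₁ + (a : ℝ) * κ₂)) / ((b : ℝ) * κ₁ + (a : ℝ) * κ₂) := div_nonneg (mul_nonneg (mul_nonneg (sub_nonneg.2 hu1) hv0) (by linarith)) hT0.le
  have hCaspec : ((1 - (x ^ 2 + (1 - x) * κ₁)) * (x ^ 2 + (1 - x) * κ₂)) * ((a : ℝ) - ((b : ℝ) * κ₁ + (a : ℝ) * κ₂)) / ((b : ℝ) * κ₁ + (a : ℝ) * κ₂) * usage x ((b : ℝ) * κ₁ + (a : ℝ) * κ₂) j'' 0 a ≤ ((1 - (x ^ 2 + (1 - x) * κ₁)) * (x ^ 2 + (1 - x) * κ₂)) := le_of_eq (by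
    rw [usage0_eq_heavy x _ j'' a hx0 hx1 (by omega) hT0 hTa hHa, div_mul_div_comm,
      div_eq_iff (mul_ne_zero hT0.ne' (by linarith : (a : ℝ) - ((b : ℝ) * κ₁ + (a : ℝ) * κ₂) ≠ 0))]
    ring)
  exact twoBlob_decAtT_of_capacity x (x ^ 2 + (1 - x) * κ₁) (x ^ 2 + (1 - x) * κ₂) ((b : ℝ) * κ₁ + (a : ℝ) * κ₂) (0) (((1 - (x ^ 2 + (1 - x) * κ₁)) * (x ^ 2 + (1 - x) * κ₂)) * ((a : ℝ) - ((b : ℝ) * κ₁ + (a : ℝ) * κ₂)) / ((b : ℝ) * κ₁ + (a : ℝ) * κ₂)) b a j'' hx0 hx1 hu0 hu1 hv0 hv1 hb ha hbaj hT0 h2b h2a hsT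
    le_rfl hCa0 (Or.inl rfl) (Or.inr ⟨hTa, hCaspec⟩)
    (cap_O_incH x κ₁ κ₂ a b j'' hx0 hx1 hk0 hkx hk20 hk2x ha hb hj h2b hTb hTa hHa)

/-- light–light law, sub-case O, cell (0,b) inc / (0,a) L. [this work] -/
theorem dec_O_incL (x κ₁ κ₂ : ℝ) (a b j'' : ℕ) (hx0 : 0 < x) (hx1 : x < 1) (hk0 : 0 < κ₁) (hkx : κ₁ < x) (hk20 : 0 < κ₂) (hk2x : κ₂ < x)
    (ha : 1 ≤ a) (hb : 1 ≤ b) (hj : a + b ≤ j'')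
    (h2b : ((b : ℝ) * κ₁ + (a : ℝ) * κ₂) ≤ 2 * (b : ℝ)) (h2a : ((b : ℝ) * κ₁ + (a : ℝ) * κ₂) ≤ 2 * (a : ℝ)) (hTb : (b : ℝ) ≤ ((b : ℝ) * κ₁ + (a : ℝ) * κ₂)) (hTa : ((b : ℝ) * κ₁ + (a : ℝ) * κ₂) < (a : ℝ)) (hLa : ((b : ℝ) * κ₁ + (a : ℝ) * κ₂) ≤ x * (a : ℝ)) :
    DECAtT x ((b : ℝ) * κ₁ + (a : ℝ) * κ₂) j'' (b + a) (fun h => LAW2[b, (x ^ 2 + (1 - x) * κ₁), a, (x ^ 2 + (1 - x) * κ₂), h]) := by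
  have ha0 : (0 : ℝ) < (a : ℝ) := by exact_mod_cast Nat.lt_of_lt_of_le Nat.zero_lt_one ha
  have hb0 : (0 : ℝ) < (b : ℝ) := by exact_mod_cast Nat.lt_of_lt_of_le Nat.zero_lt_one hb
  have hu0 : 0 ≤ x ^ 2 + (1 - x) * κ₁ := by nlinarith [mul_pos (sub_pos.2 hx1) hk0]
  have hu1 : x ^ 2 + (1 - x) * κ₁ ≤ 1 := by nlinarith [mul_lt_mul_of_pos_left hkx (sub_pos.2 hx1)]
  have hux : x ^ 2 + (1 - x) * κ₁ < x := by nlinarith [mul_lt_mul_of_pos_left hkx (sub_pos.2 hx1)]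
  have hv0 : 0 ≤ x ^ 2 + (1 - x) * κ₂ := by nlinarith [mul_pos (sub_pos.2 hx1) hk20]
  have hv1 : x ^ 2 + (1 - x) * κ₂ ≤ 1 := by nlinarith [mul_lt_mul_of_pos_left hk2x (sub_pos.2 hx1)]
  have hvx : x ^ 2 + (1 - x) * κ₂ < x := by nlinarith [mul_lt_mul_of_pos_left hk2x (sub_pos.2 hx1)]
  have hT0 : 0 < (b : ℝ) * κ₁ + (a : ℝ) * κ₂ := by nlinarith [mul_pos hb0 hk0, mul_pos ha0 hk20]
  have hsT : (b : ℝ) * κ₁ + (a : ℝ) * κ₂ < (b : ℝ) + (a : ℝ) := by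
    nlinarith [mul_pos hb0 (sub_pos.2 (hkx.trans hx1)), mul_pos ha0 (sub_pos.2 (hk2x.trans hx1))]
  have hbaj : b + a ≤ j'' := by omega
  have hna : (0:ℝ) < x ^ 2 * (a : ℝ) + (1 - x) * ((b : ℝ) * κ₁ + (a : ℝ) * κ₂) := by nlinarith [mul_pos (pow_pos hx0 2) ha0]
  have hfa : (0:ℝ) < (1 - x) * ((1 + x) * (a : ℝ) - ((b : ℝ) * κ₁ + (a : ℝ) * κ₂)) := by
    apply mul_pos (sub_pos.2 hx1); nlinarith [mul_pos hx0 ha0]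
  have hCa0 : 0 ≤ ((1 - (x ^ 2 + (1 - x) * κ₁)) * (x ^ 2 + (1 - x) * κ₂)) * ((1 - x) * ((1 + x) * (a : ℝ) - ((b : ℝ) * κ₁ + (a : ℝ) * κ₂))) / (x ^ 2 * (a : ℝ) + (1 - x) * ((b : ℝ) * κ₁ + (a : ℝ) * κ₂)) := div_nonneg (mul_nonneg (mul_nonneg (sub_nonneg.2 hu1) hv0) hfa.le) hna.le
  have hCaspec : ((1 - (x ^ 2 + (1 - x) * κ₁)) * (x ^ 2 + (1 - x) * κ₂)) * ((1 - x) * ((1 + x) * (a : ℝ) - ((b : ℝ) * κ₁ + (a : ℝ) * κ₂))) / (x ^ 2 * (a : ℝ) + (1 - x) * ((b : ℝ) * κ₁ + (a : ℝ) * κ₂)) * usage x ((b : ℝ) * κ₁ + (a : ℝ) * κ₂) j'' 0 a ≤ ((1 - (x ^ 2 + (1 - x) * κ₁)) * (x ^ 2 + (1 - x) * κ₂)) := le_of_eq (by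
    rw [usage0_eq_light x _ j'' a hx0 hx1 (by omega) hT0 hTa hLa, div_mul_div_comm, div_eq_iff (mul_ne_zero hna.ne' hfa.ne')]
    ring)
  exact twoBlob_decAtT_of_capacity x (x ^ 2 + (1 - x) * κ₁) (x ^ 2 + (1 - x) * κ₂) ((b : ℝ) * κ₁ + (a : ℝ) * κ₂) (0) (((1 - (x ^ 2 + (1 - x) * κ₁)) * (x ^ 2 + (1 - x) * κ₂)) * ((1 - x) * ((1 + x) * (a : ℝ) - ((b : ℝ) * κ₁ + (a : ℝ) * κ₂))) / (x ^ 2 * (a : ℝ) + (1 - x) * ((b : ℝ) * κ₁ + (a : ℝ) * κ₂))) b a j'' hx0 hx1 hu0 hu1 hv0 hv1 hb ha hbaj hT0 h2b h2a hsT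
    le_rfl hCa0 (Or.inl rfl) (Or.inr ⟨hTa, hCaspec⟩)
    (cap_O_incL x κ₁ κ₂ a b j'' hx0 hx1 hk0 hkx hk20 hk2x ha hb hj h2b hTb hTa hLa)

/-- light–light law, sub-case O, cell (0,b) H / (0,a) inc. [this work] -/
theorem dec_O_Hinc (x κ₁ κ₂ : ℝ) (a b j'' : ℕ) (hx0 : 0 < x) (hx1 : x < 1) (hk0 : 0 < κ₁) (hkx : κ₁ < x) (hk20 : 0 < κ₂) (hk2x : κ₂ < x)
    (ha : 1 ≤ a) (hb : 1 ≤ b) (hj : a + b ≤ j'')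
    (h2b : ((b : ℝ) * κ₁ + (a : ℝ) * κ₂) ≤ 2 * (b : ℝ)) (h2a : ((b : ℝ) * κ₁ + (a : ℝ) * κ₂) ≤ 2 * (a : ℝ)) (hTb : ((b : ℝ) * κ₁ + (a : ℝ) * κ₂) < (b : ℝ)) (hHb : x * (b : ℝ) ≤ ((b : ℝ) * κ₁ + (a : ℝ) * κ₂)) (hTa : (a : ℝ) ≤ ((b : ℝ) * κ₁ + (a : ℝ) * κ₂)) :
    DECAtT x ((b : ℝ) * κ₁ + (a : ℝ) * κ₂) j'' (b + a) (fun h => LAW2[b, (x ^ 2 + (1 - x) * κ₁), a, (x ^ 2 + (1 - x) * κ₂), h]) := by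
  have ha0 : (0 : ℝ) < (a : ℝ) := by exact_mod_cast Nat.lt_of_lt_of_le Nat.zero_lt_one ha
  have hb0 : (0 : ℝ) < (b : ℝ) := by exact_mod_cast Nat.lt_of_lt_of_le Nat.zero_lt_one hb
  have hu0 : 0 ≤ x ^ 2 + (1 - x) * κ₁ := by nlinarith [mul_pos (sub_pos.2 hx1) hk0]
  have hu1 : x ^ 2 + (1 - x) * κ₁ ≤ 1 := by nlinarith [mul_lt_mul_of_pos_left hkx (sub_pos.2 hx1)]
  have hux : x ^ 2 + (1 - x) * κ₁ < x := by nlinarith [mul_lt_mul_of_pos_left hkx (sub_pos.2 hx1)]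
  have hv0 : 0 ≤ x ^ 2 + (1 - x) * κ₂ := by nlinarith [mul_pos (sub_pos.2 hx1) hk20]
  have hv1 : x ^ 2 + (1 - x) * κ₂ ≤ 1 := by nlinarith [mul_lt_mul_of_pos_left hk2x (sub_pos.2 hx1)]
  have hvx : x ^ 2 + (1 - x) * κ₂ < x := by nlinarith [mul_lt_mul_of_pos_left hk2x (sub_pos.2 hx1)]
  have hT0 : 0 < (b : ℝ) * κ₁ + (a : ℝ) * κ₂ := by nlinarith [mul_pos hb0 hk0, mul_pos ha0 hk20]
  have hsT : (b : ℝ) * κ₁ + (a : ℝ) * κ₂ < (b : ℝ) + (a : ℝ) := by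
    nlinarith [mul_pos hb0 (sub_pos.2 (hkx.trans hx1)), mul_pos ha0 (sub_pos.2 (hk2x.trans hx1))]
  have hbaj : b + a ≤ j'' := by omega
  have hCb0 : 0 ≤ ((x ^ 2 + (1 - x) * κ₁) * (1 - (x ^ 2 + (1 - x) * κ₂))) * ((b : ℝ) - ((b : ℝ) * κ₁ + (a : ℝ) * κ₂)) / ((b : ℝ) * κ₁ + (a : ℝ) * κ₂) := div_nonneg (mul_nonneg (mul_nonneg hu0 (sub_nonneg.2 hv1)) (by linarith)) hT0.le
  have hCbspec : ((x ^ 2 + (1 - x) * κ₁) * (1 - (x ^ 2 + (1 - x) * κ₂))) * ((b : ℝ) - ((b : ℝ) * κ₁ + (a : ℝ) * κ₂)) / ((b : ℝ) * κ₁ + (a : ℝ) * κ₂) * usage x ((b : ℝ) * κ₁ + (a : ℝ) * κ₂) j'' 0 b ≤ ((x ^ 2 + (1 - x) * κ₁) * (1 - (x ^ 2 + (1 - x) * κ₂))) := le_of_eq (by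
    rw [usage0_eq_heavy x _ j'' b hx0 hx1 (by omega) hT0 hTb hHb, div_mul_div_comm,
      div_eq_iff (mul_ne_zero hT0.ne' (by linarith : (b : ℝ) - ((b : ℝ) * κ₁ + (a : ℝ) * κ₂) ≠ 0))]
    ring)
  exact twoBlob_decAtT_of_capacity x (x ^ 2 + (1 - x) * κ₁) (x ^ 2 + (1 - x) * κ₂) ((b : ℝ) * κ₁ + (a : ℝ) * κ₂) (((x ^ 2 + (1 - x) * κ₁) * (1 - (x ^ 2 + (1 - x) * κ₂))) * ((b : ℝ) - ((b : ℝ) * κ₁ + (a : ℝ) * κ₂)) / ((b : ℝ) * κ₁ + (a : ℝ) * κ₂)) (0) b a j'' hx0 hx1 hu0 hu1 hv0 hv1 hb ha hbaj hT0 h2b h2a hsT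
    hCb0 le_rfl (Or.inr ⟨hTb, hCbspec⟩) (Or.inl rfl)
    (cap_O_Hinc x κ₁ κ₂ a b j'' hx0 hx1 hk0 hkx hk20 hk2x ha hb hj h2a hTb hHb hTa)

/-- light–light law, sub-case O, cell (0,b) H / (0,a) H. [this work] -/
theorem dec_O_HH (x κ₁ κ₂ : ℝ) (a b j'' : ℕ) (hx0 : 0 < x) (hx1 : x < 1) (hk0 : 0 < κ₁) (hkx : κ₁ < x) (hk20 : 0 < κ₂) (hk2x : κ₂ < x)
    (ha : 1 ≤ a) (hb : 1 ≤ b) (hj : a + b ≤ j'')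
    (h2b : ((b : ℝ) * κ₁ + (a : ℝ) * κ₂) ≤ 2 * (b : ℝ)) (h2a : ((b : ℝ) * κ₁ + (a : ℝ) * κ₂) ≤ 2 * (a : ℝ)) (hTb : ((b : ℝ) * κ₁ + (a : ℝ) * κ₂) < (b : ℝ)) (hHb : x * (b : ℝ) ≤ ((b : ℝ) * κ₁ + (a : ℝ) * κ₂)) (hTa : ((b : ℝ) * κ₁ + (a : ℝ) * κ₂) < (a : ℝ)) (hHa : x * (a : ℝ) ≤ ((b : ℝ) * κ₁ + (a : ℝ) * κ₂)) :
    DECAtT x ((b : ℝ) * κ₁ + (a : ℝ) * κ₂) j'' (b + a) (fun h => LAW2[b, (x ^ 2 + (1 - x) * κ₁), a, (x ^ 2 + (1 - x) * κ₂), h]) := by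
  have ha0 : (0 : ℝ) < (a : ℝ) := by exact_mod_cast Nat.lt_of_lt_of_le Nat.zero_lt_one ha
  have hb0 : (0 : ℝ) < (b : ℝ) := by exact_mod_cast Nat.lt_of_lt_of_le Nat.zero_lt_one hb
  have hu0 : 0 ≤ x ^ 2 + (1 - x) * κ₁ := by nlinarith [mul_pos (sub_pos.2 hx1) hk0]
  have hu1 : x ^ 2 + (1 - x) * κ₁ ≤ 1 := by nlinarith [mul_lt_mul_of_pos_left hkx (sub_pos.2 hx1)]
  have hux : x ^ 2 + (1 - x) * κ₁ < x := by nlinarith [mul_lt_mul_of_pos_left hkx (sub_pos.2 hx1)]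
  have hv0 : 0 ≤ x ^ 2 + (1 - x) * κ₂ := by nlinarith [mul_pos (sub_pos.2 hx1) hk20]
  have hv1 : x ^ 2 + (1 - x) * κ₂ ≤ 1 := by nlinarith [mul_lt_mul_of_pos_left hk2x (sub_pos.2 hx1)]
  have hvx : x ^ 2 + (1 - x) * κ₂ < x := by nlinarith [mul_lt_mul_of_pos_left hk2x (sub_pos.2 hx1)]
  have hT0 : 0 < (b : ℝ) * κ₁ + (a : ℝ) * κ₂ := by nlinarith [mul_pos hb0 hk0, mul_pos ha0 hk20]
  have hsT : (b : ℝ) * κ₁ + (a : ℝ) * κ₂ < (b : ℝ) + (a : ℝ) := by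
    nlinarith [mul_pos hb0 (sub_pos.2 (hkx.trans hx1)), mul_pos ha0 (sub_pos.2 (hk2x.trans hx1))]
  have hbaj : b + a ≤ j'' := by omega
  have hCb0 : 0 ≤ ((x ^ 2 + (1 - x) * κ₁) * (1 - (x ^ 2 + (1 - x) * κ₂))) * ((b : ℝ) - ((b : ℝ) * κ₁ + (a : ℝ) * κ₂)) / ((b : ℝ) * κ₁ + (a : ℝ) * κ₂) := div_nonneg (mul_nonneg (mul_nonneg hu0 (sub_nonneg.2 hv1)) (by linarith)) hT0.le
  have hCbspec : ((x ^ 2 + (1 - x) * κ₁) * (1 - (x ^ 2 + (1 - x) * κ₂))) * ((b : ℝ) - ((b : ℝ) * κ₁ + (a : ℝ) * κ₂)) / ((b : ℝ) * κ₁ + (a : ℝ) * κ₂) * usage x ((b : ℝ) * κ₁ + (a : ℝ) * κ₂) j'' 0 b ≤ ((x ^ 2 + (1 - x) * κ₁) * (1 - (x ^ 2 + (1 - x) * κ₂))) := le_of_eq (by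
    rw [usage0_eq_heavy x _ j'' b hx0 hx1 (by omega) hT0 hTb hHb, div_mul_div_comm,
      div_eq_iff (mul_ne_zero hT0.ne' (by linarith : (b : ℝ) - ((b : ℝ) * κ₁ + (a : ℝ) * κ₂) ≠ 0))]
    ring)
  have hCa0 : 0 ≤ ((1 - (x ^ 2 + (1 - x) * κ₁)) * (x ^ 2 + (1 - x) * κ₂)) * ((a : ℝ) - ((b : ℝ) * κ₁ + (a : ℝ) * κ₂)) / ((b : ℝ) * κ₁ + (a : ℝ) * κ₂) := div_nonneg (mul_nonneg (mul_nonneg (sub_nonneg.2 hu1) hv0) (by linarith)) hT0.le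
  have hCaspec : ((1 - (x ^ 2 + (1 - x) * κ₁)) * (x ^ 2 + (1 - x) * κ₂)) * ((a : ℝ) - ((b : ℝ) * κ₁ + (a : ℝ) * κ₂)) / ((b : ℝ) * κ₁ + (a : ℝ) * κ₂) * usage x ((b : ℝ) * κ₁ + (a : ℝ) * κ₂) j'' 0 a ≤ ((1 - (x ^ 2 + (1 - x) * κ₁)) * (x ^ 2 + (1 - x) * κ₂)) := le_of_eq (by
    rw [usage0_eq_heavy x _ j'' a hx0 hx1 (by omega) hT0 hTa hHa, div_mul_div_comm,
      div_eq_iff (mul_ne_zero hT0.ne' (by linarith : (a : ℝ) - ((b : ℝ) * κ₁ + (a : ℝ) * κ₂) ≠ 0))]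
    ring)
  exact twoBlob_decAtT_of_capacity x (x ^ 2 + (1 - x) * κ₁) (x ^ 2 + (1 - x) * κ₂) ((b : ℝ) * κ₁ + (a : ℝ) * κ₂) (((x ^ 2 + (1 - x) * κ₁) * (1 - (x ^ 2 + (1 - x) * κ₂))) * ((b : ℝ) - ((b : ℝ) * κ₁ + (a : ℝ) * κ₂)) / ((b : ℝ) * κ₁ + (a : ℝ) * κ₂)) (((1 - (x ^ 2 + (1 - x) * κ₁)) * (x ^ 2 + (1 - x) * κ₂)) * ((a : ℝ) - ((b : ℝ) * κ₁ + (a : ℝ) * κ₂)) / ((b : ℝ) * κ₁ + (a : ℝ) * κ₂)) b a j'' hx0 hx1 hu0 hu1 hv0 hv1 hb ha hbaj hT0 h2b h2a hsT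
    hCb0 hCa0 (Or.inr ⟨hTb, hCbspec⟩) (Or.inr ⟨hTa, hCaspec⟩)
    (cap_O_HH x κ₁ κ₂ a b j'' hx0 hx1 hk0 hkx hk20 hk2x ha hb hj  hTb hHb hTa hHa)

/-- light–light law, sub-case O, cell (0,b) H / (0,a) L. [this work] -/
theorem dec_O_HL (x κ₁ κ₂ : ℝ) (a b j'' : ℕ) (hx0 : 0 < x) (hx1 : x < 1) (hk0 : 0 < κ₁) (hkx : κ₁ < x) (hk20 : 0 < κ₂) (hk2x : κ₂ < x)
    (ha : 1 ≤ a) (hb : 1 ≤ b) (hj : a + b ≤ j'')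
    (h2b : ((b : ℝ) * κ₁ + (a : ℝ) * κ₂) ≤ 2 * (b : ℝ)) (h2a : ((b : ℝ) * κ₁ + (a : ℝ) * κ₂) ≤ 2 * (a : ℝ)) (hTb : ((b : ℝ) * κ₁ + (a : ℝ) * κ₂) < (b : ℝ)) (hHb : x * (b : ℝ) ≤ ((b : ℝ) * κ₁ + (a : ℝ) * κ₂)) (hTa : ((b : ℝ) * κ₁ + (a : ℝ) * κ₂) < (a : ℝ)) (hLa : ((b : ℝ) * κ₁ + (a : ℝ) * κ₂) ≤ x * (a : ℝ)) :
    DECAtT x ((b : ℝ) * κ₁ + (a : ℝ) * κ₂) j'' (b + a) (fun h => LAW2[b, (x ^ 2 + (1 - x) * κ₁), a, (x ^ 2 + (1 - x) * κ₂), h]) := by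
  have ha0 : (0 : ℝ) < (a : ℝ) := by exact_mod_cast Nat.lt_of_lt_of_le Nat.zero_lt_one ha
  have hb0 : (0 : ℝ) < (b : ℝ) := by exact_mod_cast Nat.lt_of_lt_of_le Nat.zero_lt_one hb
  have hu0 : 0 ≤ x ^ 2 + (1 - x) * κ₁ := by nlinarith [mul_pos (sub_pos.2 hx1) hk0]
  have hu1 : x ^ 2 + (1 - x) * κ₁ ≤ 1 := by nlinarith [mul_lt_mul_of_pos_left hkx (sub_pos.2 hx1)]
  have hux : x ^ 2 + (1 - x) * κ₁ < x := by nlinarith [mul_lt_mul_of_pos_left hkx (sub_pos.2 hx1)]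
  have hv0 : 0 ≤ x ^ 2 + (1 - x) * κ₂ := by nlinarith [mul_pos (sub_pos.2 hx1) hk20]
  have hv1 : x ^ 2 + (1 - x) * κ₂ ≤ 1 := by nlinarith [mul_lt_mul_of_pos_left hk2x (sub_pos.2 hx1)]
  have hvx : x ^ 2 + (1 - x) * κ₂ < x := by nlinarith [mul_lt_mul_of_pos_left hk2x (sub_pos.2 hx1)]
  have hT0 : 0 < (b : ℝ) * κ₁ + (a : ℝ) * κ₂ := by nlinarith [mul_pos hb0 hk0, mul_pos ha0 hk20]
  have hsT : (b : ℝ) * κ₁ + (a : ℝ) * κ₂ < (b : ℝ) + (a : ℝ) := by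
    nlinarith [mul_pos hb0 (sub_pos.2 (hkx.trans hx1)), mul_pos ha0 (sub_pos.2 (hk2x.trans hx1))]
  have hbaj : b + a ≤ j'' := by omega
  have hCb0 : 0 ≤ ((x ^ 2 + (1 - x) * κ₁) * (1 - (x ^ 2 + (1 - x) * κ₂))) * ((b : ℝ) - ((b : ℝ) * κ₁ + (a : ℝ) * κ₂)) / ((b : ℝ) * κ₁ + (a : ℝ) * κ₂) := div_nonneg (mul_nonneg (mul_nonneg hu0 (sub_nonneg.2 hv1)) (by linarith)) hT0.le
  have hCbspec : ((x ^ 2 + (1 - x) * κ₁) * (1 - (x ^ 2 + (1 - x) * κ₂))) * ((b : ℝ) - ((b : ℝ) * κ₁ + (a : ℝ) * κ₂)) / ((b : ℝ) * κ₁ + (a : ℝ) * κ₂) * usage x ((b : ℝ) * κ₁ + (a : ℝ) * κ₂) j'' 0 b ≤ ((x ^ 2 + (1 - x) * κ₁) * (1 - (x ^ 2 + (1 - x) * κ₂))) := le_of_eq (by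
    rw [usage0_eq_heavy x _ j'' b hx0 hx1 (by omega) hT0 hTb hHb, div_mul_div_comm,
      div_eq_iff (mul_ne_zero hT0.ne' (by linarith : (b : ℝ) - ((b : ℝ) * κ₁ + (a : ℝ) * κ₂) ≠ 0))]
    ring)
  have hna : (0:ℝ) < x ^ 2 * (a : ℝ) + (1 - x) * ((b : ℝ) * κ₁ + (a : ℝ) * κ₂) := by nlinarith [mul_pos (pow_pos hx0 2) ha0]
  have hfa : (0:ℝ) < (1 - x) * ((1 + x) * (a : ℝ) - ((b : ℝ) * κ₁ + (a : ℝ) * κ₂)) := by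
    apply mul_pos (sub_pos.2 hx1); nlinarith [mul_pos hx0 ha0]
  have hCa0 : 0 ≤ ((1 - (x ^ 2 + (1 - x) * κ₁)) * (x ^ 2 + (1 - x) * κ₂)) * ((1 - x) * ((1 + x) * (a : ℝ) - ((b : ℝ) * κ₁ + (a : ℝ) * κ₂))) / (x ^ 2 * (a : ℝ) + (1 - x) * ((b : ℝ) * κ₁ + (a : ℝ) * κ₂)) := div_nonneg (mul_nonneg (mul_nonneg (sub_nonneg.2 hu1) hv0) hfa.le) hna.le
  have hCaspec : ((1 - (x ^ 2 + (1 - x) * κ₁)) * (x ^ 2 + (1 - x) * κ₂)) * ((1 - x) * ((1 + x) * (a : ℝ) - ((b : ℝ) * κ₁ + (a : ℝ) * κ₂))) / (x ^ 2 * (a : ℝ) + (1 - x) * ((b : ℝ) * κ₁ + (a : ℝ) * κ₂)) * usage x ((b : ℝ) * κ₁ + (a : ℝ) * κ₂) j'' 0 a ≤ ((1 - (x ^ 2 + (1 - x) * κ₁)) * (x ^ 2 + (1 - x) * κ₂)) := le_of_eq (by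
    rw [usage0_eq_light x _ j'' a hx0 hx1 (by omega) hT0 hTa hLa, div_mul_div_comm, div_eq_iff (mul_ne_zero hna.ne' hfa.ne')]
    ring)
  exact twoBlob_decAtT_of_capacity x (x ^ 2 + (1 - x) * κ₁) (x ^ 2 + (1 - x) * κ₂) ((b : ℝ) * κ₁ + (a : ℝ) * κ₂) (((x ^ 2 + (1 - x) * κ₁) * (1 - (x ^ 2 + (1 - x) * κ₂))) * ((b : ℝ) - ((b : ℝ) * κ₁ + (a : ℝ) * κ₂)) / ((b : ℝ) * κ₁ + (a : ℝ) * κ₂)) (((1 - (x ^ 2 + (1 - x) * κ₁)) * (x ^ 2 + (1 - x) * κ₂)) * ((1 - x) * ((1 + x) * (a : ℝ) - ((b : ℝ) * κ₁ + (a : ℝ) * κ₂))) / (x ^ 2 * (a : ℝ) + (1 - x) * ((b : ℝ) * κ₁ + (a : ℝ) * κ₂))) b a j'' hx0 hx1 hu0 hu1 hv0 hv1 hb ha hbaj hT0 h2b h2a hsT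
    hCb0 hCa0 (Or.inr ⟨hTb, hCbspec⟩) (Or.inr ⟨hTa, hCaspec⟩)
    (cap_O_HL x κ₁ κ₂ a b j'' hx0 hx1 hk0 hkx hk20 hk2x ha hb hj  hTb hHb hTa hLa)

/-- light–light law, sub-case O, cell (0,b) L / (0,a) inc. [this work] -/
theorem dec_O_Linc (x κ₁ κ₂ : ℝ) (a b j'' : ℕ) (hx0 : 0 < x) (hx1 : x < 1) (hk0 : 0 < κ₁) (hkx : κ₁ < x) (hk20 : 0 < κ₂) (hk2x : κ₂ < x)
    (ha : 1 ≤ a) (hb : 1 ≤ b) (hj : a + b ≤ j'')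
    (h2b : ((b : ℝ) * κ₁ + (a : ℝ) * κ₂) ≤ 2 * (b : ℝ)) (h2a : ((b : ℝ) * κ₁ + (a : ℝ) * κ₂) ≤ 2 * (a : ℝ)) (hTb : ((b : ℝ) * κ₁ + (a : ℝ) * κ₂) < (b : ℝ)) (hLb : ((b : ℝ) * κ₁ + (a : ℝ) * κ₂) ≤ x * (b : ℝ)) (hTa : (a : ℝ) ≤ ((b : ℝ) * κ₁ + (a : ℝ) * κ₂)) :
    DECAtT x ((b : ℝ) * κ₁ + (a : ℝ) * κ₂) j'' (b + a) (fun h => LAW2[b, (x ^ 2 + (1 - x) * κ₁), a, (x ^ 2 + (1 - x) * κ₂), h]) := by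
  have ha0 : (0 : ℝ) < (a : ℝ) := by exact_mod_cast Nat.lt_of_lt_of_le Nat.zero_lt_one ha
  have hb0 : (0 : ℝ) < (b : ℝ) := by exact_mod_cast Nat.lt_of_lt_of_le Nat.zero_lt_one hb
  have hu0 : 0 ≤ x ^ 2 + (1 - x) * κ₁ := by nlinarith [mul_pos (sub_pos.2 hx1) hk0]
  have hu1 : x ^ 2 + (1 - x) * κ₁ ≤ 1 := by nlinarith [mul_lt_mul_of_pos_left hkx (sub_pos.2 hx1)]
  have hux : x ^ 2 + (1 - x) * κ₁ < x := by nlinarith [mul_lt_mul_of_pos_left hkx (sub_pos.2 hx1)]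
  have hv0 : 0 ≤ x ^ 2 + (1 - x) * κ₂ := by nlinarith [mul_pos (sub_pos.2 hx1) hk20]
  have hv1 : x ^ 2 + (1 - x) * κ₂ ≤ 1 := by nlinarith [mul_lt_mul_of_pos_left hk2x (sub_pos.2 hx1)]
  have hvx : x ^ 2 + (1 - x) * κ₂ < x := by nlinarith [mul_lt_mul_of_pos_left hk2x (sub_pos.2 hx1)]
  have hT0 : 0 < (b : ℝ) * κ₁ + (a : ℝ) * κ₂ := by nlinarith [mul_pos hb0 hk0, mul_pos ha0 hk20]
  have hsT : (b : ℝ) * κ₁ + (a : ℝ) * κ₂ < (b : ℝ) + (a : ℝ) := by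
    nlinarith [mul_pos hb0 (sub_pos.2 (hkx.trans hx1)), mul_pos ha0 (sub_pos.2 (hk2x.trans hx1))]
  have hbaj : b + a ≤ j'' := by omega
  have hnb : (0:ℝ) < x ^ 2 * (b : ℝ) + (1 - x) * ((b : ℝ) * κ₁ + (a : ℝ) * κ₂) := by nlinarith [mul_pos (pow_pos hx0 2) hb0]
  have hfb : (0:ℝ) < (1 - x) * ((1 + x) * (b : ℝ) - ((b : ℝ) * κ₁ + (a : ℝ) * κ₂)) := by
    apply mul_pos (sub_pos.2 hx1); nlinarith [mul_pos hx0 hb0]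
  have hCb0 : 0 ≤ ((x ^ 2 + (1 - x) * κ₁) * (1 - (x ^ 2 + (1 - x) * κ₂))) * ((1 - x) * ((1 + x) * (b : ℝ) - ((b : ℝ) * κ₁ + (a : ℝ) * κ₂))) / (x ^ 2 * (b : ℝ) + (1 - x) * ((b : ℝ) * κ₁ + (a : ℝ) * κ₂)) := div_nonneg (mul_nonneg (mul_nonneg hu0 (sub_nonneg.2 hv1)) hfb.le) hnb.le
  have hCbspec : ((x ^ 2 + (1 - x) * κ₁) * (1 - (x ^ 2 + (1 - x) * κ₂))) * ((1 - x) * ((1 + x) * (b : ℝ) - ((b : ℝ) * κ₁ + (a : ℝ) * κ₂))) / (x ^ 2 * (b : ℝ) + (1 - x) * ((b : ℝ) * κ₁ + (a : ℝ) * κ₂)) * usage x ((b : ℝ) * κ₁ + (a : ℝ) * κ₂) j'' 0 b ≤ ((x ^ 2 + (1 - x) * κ₁) * (1 - (x ^ 2 + (1 - x) * κ₂))) := le_of_eq (by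
    rw [usage0_eq_light x _ j'' b hx0 hx1 (by omega) hT0 hTb hLb, div_mul_div_comm, div_eq_iff (mul_ne_zero hnb.ne' hfb.ne')]
    ring)
  exact twoBlob_decAtT_of_capacity x (x ^ 2 + (1 - x) * κ₁) (x ^ 2 + (1 - x) * κ₂) ((b : ℝ) * κ₁ + (a : ℝ) * κ₂) (((x ^ 2 + (1 - x) * κ₁) * (1 - (x ^ 2 + (1 - x) * κ₂))) * ((1 - x) * ((1 + x) * (b : ℝ) - ((b : ℝ) * κ₁ + (a : ℝ) * κ₂))) / (x ^ 2 * (b : ℝ) + (1 - x) * ((b : ℝ) * κ₁ + (a : ℝ) * κ₂))) (0) b a j'' hx0 hx1 hu0 hu1 hv0 hv1 hb ha hbaj hT0 h2b h2a hsT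
    hCb0 le_rfl (Or.inr ⟨hTb, hCbspec⟩) (Or.inl rfl)
    (cap_O_Linc x κ₁ κ₂ a b j'' hx0 hx1 hk0 hkx hk20 hk2x ha hb hj h2a hTb hLb hTa)

/-- light–light law, sub-case O, cell (0,b) L / (0,a) H. [this work] -/
theorem dec_O_LH (x κ₁ κ₂ : ℝ) (a b j'' : ℕ) (hx0 : 0 < x) (hx1 : x < 1) (hk0 : 0 < κ₁) (hkx : κ₁ < x) (hk20 : 0 < κ₂) (hk2x : κ₂ < x)
    (ha : 1 ≤ a) (hb : 1 ≤ b) (hj : a + b ≤ j'')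
    (h2b : ((b : ℝ) * κ₁ + (a : ℝ) * κ₂) ≤ 2 * (b : ℝ)) (h2a : ((b : ℝ) * κ₁ + (a : ℝ) * κ₂) ≤ 2 * (a : ℝ)) (hTb : ((b : ℝ) * κ₁ + (a : ℝ) * κ₂) < (b : ℝ)) (hLb : ((b : ℝ) * κ₁ + (a : ℝ) * κ₂) ≤ x * (b : ℝ)) (hTa : ((b : ℝ) * κ₁ + (a : ℝ) * κ₂) < (a : ℝ)) (hHa : x * (a : ℝ) ≤ ((b : ℝ) * κ₁ + (a : ℝ) * κ₂)) :
    DECAtT x ((b : ℝ) * κ₁ + (a : ℝ) * κ₂) j'' (b + a) (fun h => LAW2[b, (x ^ 2 + (1 - x) * κ₁), a, (x ^ 2 + (1 - x) * κ₂), h]) := by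
  have ha0 : (0 : ℝ) < (a : ℝ) := by exact_mod_cast Nat.lt_of_lt_of_le Nat.zero_lt_one ha
  have hb0 : (0 : ℝ) < (b : ℝ) := by exact_mod_cast Nat.lt_of_lt_of_le Nat.zero_lt_one hb
  have hu0 : 0 ≤ x ^ 2 + (1 - x) * κ₁ := by nlinarith [mul_pos (sub_pos.2 hx1) hk0]
  have hu1 : x ^ 2 + (1 - x) * κ₁ ≤ 1 := by nlinarith [mul_lt_mul_of_pos_left hkx (sub_pos.2 hx1)]
  have hux : x ^ 2 + (1 - x) * κ₁ < x := by nlinarith [mul_lt_mul_of_pos_left hkx (sub_pos.2 hx1)]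
  have hv0 : 0 ≤ x ^ 2 + (1 - x) * κ₂ := by nlinarith [mul_pos (sub_pos.2 hx1) hk20]
  have hv1 : x ^ 2 + (1 - x) * κ₂ ≤ 1 := by nlinarith [mul_lt_mul_of_pos_left hk2x (sub_pos.2 hx1)]
  have hvx : x ^ 2 + (1 - x) * κ₂ < x := by nlinarith [mul_lt_mul_of_pos_left hk2x (sub_pos.2 hx1)]
  have hT0 : 0 < (b : ℝ) * κ₁ + (a : ℝ) * κ₂ := by nlinarith [mul_pos hb0 hk0, mul_pos ha0 hk20]
  have hsT : (b : ℝ) * κ₁ + (a : ℝ) * κ₂ < (b : ℝ) + (a : ℝ) := by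
    nlinarith [mul_pos hb0 (sub_pos.2 (hkx.trans hx1)), mul_pos ha0 (sub_pos.2 (hk2x.trans hx1))]
  have hbaj : b + a ≤ j'' := by omega
  have hnb : (0:ℝ) < x ^ 2 * (b : ℝ) + (1 - x) * ((b : ℝ) * κ₁ + (a : ℝ) * κ₂) := by nlinarith [mul_pos (pow_pos hx0 2) hb0]
  have hfb : (0:ℝ) < (1 - x) * ((1 + x) * (b : ℝ) - ((b : ℝ) * κ₁ + (a : ℝ) * κ₂)) := by
    apply mul_pos (sub_pos.2 hx1); nlinarith [mul_pos hx0 hb0]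
  have hCb0 : 0 ≤ ((x ^ 2 + (1 - x) * κ₁) * (1 - (x ^ 2 + (1 - x) * κ₂))) * ((1 - x) * ((1 + x) * (b : ℝ) - ((b : ℝ) * κ₁ + (a : ℝ) * κ₂))) / (x ^ 2 * (b : ℝ) + (1 - x) * ((b : ℝ) * κ₁ + (a : ℝ) * κ₂)) := div_nonneg (mul_nonneg (mul_nonneg hu0 (sub_nonneg.2 hv1)) hfb.le) hnb.le
  have hCbspec : ((x ^ 2 + (1 - x) * κ₁) * (1 - (x ^ 2 + (1 - x) * κ₂))) * ((1 - x) * ((1 + x) * (b : ℝ) - ((b : ℝ) * κ₁ + (a : ℝ) * κ₂))) / (x ^ 2 * (b : ℝ) + (1 - x) * ((b : ℝ) * κ₁ + (a : ℝ) * κ₂)) * usage x ((b : ℝ) * κ₁ + (a : ℝ) * κ₂) j'' 0 b ≤ ((x ^ 2 + (1 - x) * κ₁) * (1 - (x ^ 2 + (1 - x) * κ₂))) := le_of_eq (by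
    rw [usage0_eq_light x _ j'' b hx0 hx1 (by omega) hT0 hTb hLb, div_mul_div_comm, div_eq_iff (mul_ne_zero hnb.ne' hfb.ne')]
    ring)
  have hCa0 : 0 ≤ ((1 - (x ^ 2 + (1 - x) * κ₁)) * (x ^ 2 + (1 - x) * κ₂)) * ((a : ℝ) - ((b : ℝ) * κ₁ + (a : ℝ) * κ₂)) / ((b : ℝ) * κ₁ + (a : ℝ) * κ₂) := div_nonneg (mul_nonneg (mul_nonneg (sub_nonneg.2 hu1) hv0) (by linarith)) hT0.le
  have hCaspec : ((1 - (x ^ 2 + (1 - x) * κ₁)) * (x ^ 2 + (1 - x) * κ₂)) * ((a : ℝ) - ((b : ℝ) * κ₁ + (a : ℝ) * κ₂)) / ((b : ℝ) * κ₁ + (a : ℝ) * κ₂) * usage x ((b : ℝ) * κ₁ + (a : ℝ) * κ₂) j'' 0 a ≤ ((1 - (x ^ 2 + (1 - x) * κ₁)) * (x ^ 2 + (1 - x) * κ₂)) := le_of_eq (by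
    rw [usage0_eq_heavy x _ j'' a hx0 hx1 (by omega) hT0 hTa hHa, div_mul_div_comm,
      div_eq_iff (mul_ne_zero hT0.ne' (by linarith : (a : ℝ) - ((b : ℝ) * κ₁ + (a : ℝ) * κ₂) ≠ 0))]
    ring)
  exact twoBlob_decAtT_of_capacity x (x ^ 2 + (1 - x) * κ₁) (x ^ 2 + (1 - x) * κ₂) ((b : ℝ) * κ₁ + (a : ℝ) * κ₂) (((x ^ 2 + (1 - x) * κ₁) * (1 - (x ^ 2 + (1 - x) * κ₂))) * ((1 - x) * ((1 + x) * (b : ℝ) - ((b : ℝ) * κ₁ + (a : ℝ) * κ₂))) / (x ^ 2 * (b : ℝ) + (1 - x) * ((b : ℝ) * κ₁ + (a : ℝ) * κ₂))) (((1 - (x ^ 2 + (1 - x) * κ₁)) * (x ^ 2 + (1 - x) * κ₂)) * ((a : ℝ) - ((b : ℝ) * κ₁ + (a : ℝ) * κ₂)) / ((b : ℝ) * κ₁ + (a : ℝ) * κ₂)) b a j'' hx0 hx1 hu0 hu1 hv0 hv1 hb ha hbaj hT0 h2b h2a hsT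
    hCb0 hCa0 (Or.inr ⟨hTb, hCbspec⟩) (Or.inr ⟨hTa, hCaspec⟩)
    (cap_O_LH x κ₁ κ₂ a b j'' hx0 hx1 hk0 hkx hk20 hk2x ha hb hj  hTb hLb hTa hHa)

/-- light–light law, sub-case O, cell (0,b) L / (0,a) L. [this work] -/
theorem dec_O_LL (x κ₁ κ₂ : ℝ) (a b j'' : ℕ) (hx0 : 0 < x) (hx1 : x < 1) (hk0 : 0 < κ₁) (hkx : κ₁ < x) (hk20 : 0 < κ₂) (hk2x : κ₂ < x)
    (ha : 1 ≤ a) (hb : 1 ≤ b) (hj : a + b ≤ j'')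
    (h2b : ((b : ℝ) * κ₁ + (a : ℝ) * κ₂) ≤ 2 * (b : ℝ)) (h2a : ((b : ℝ) * κ₁ + (a : ℝ) * κ₂) ≤ 2 * (a : ℝ)) (hTb : ((b : ℝ) * κ₁ + (a : ℝ) * κ₂) < (b : ℝ)) (hLb : ((b : ℝ) * κ₁ + (a : ℝ) * κ₂) ≤ x * (b : ℝ)) (hTa : ((b : ℝ) * κ₁ + (a : ℝ) * κ₂) < (a : ℝ)) (hLa : ((b : ℝ) * κ₁ + (a : ℝ) * κ₂) ≤ x * (a : ℝ)) :
    DECAtT x ((b : ℝ) * κ₁ + (a : ℝ) * κ₂) j'' (b + a) (fun h => LAW2[b, (x ^ 2 + (1 - x) * κ₁), a, (x ^ 2 + (1 - x) * κ₂), h]) := by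
  have ha0 : (0 : ℝ) < (a : ℝ) := by exact_mod_cast Nat.lt_of_lt_of_le Nat.zero_lt_one ha
  have hb0 : (0 : ℝ) < (b : ℝ) := by exact_mod_cast Nat.lt_of_lt_of_le Nat.zero_lt_one hb
  have hu0 : 0 ≤ x ^ 2 + (1 - x) * κ₁ := by nlinarith [mul_pos (sub_pos.2 hx1) hk0]
  have hu1 : x ^ 2 + (1 - x) * κ₁ ≤ 1 := by nlinarith [mul_lt_mul_of_pos_left hkx (sub_pos.2 hx1)]
  have hux : x ^ 2 + (1 - x) * κ₁ < x := by nlinarith [mul_lt_mul_of_pos_left hkx (sub_pos.2 hx1)]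
  have hv0 : 0 ≤ x ^ 2 + (1 - x) * κ₂ := by nlinarith [mul_pos (sub_pos.2 hx1) hk20]
  have hv1 : x ^ 2 + (1 - x) * κ₂ ≤ 1 := by nlinarith [mul_lt_mul_of_pos_left hk2x (sub_pos.2 hx1)]
  have hvx : x ^ 2 + (1 - x) * κ₂ < x := by nlinarith [mul_lt_mul_of_pos_left hk2x (sub_pos.2 hx1)]
  have hT0 : 0 < (b : ℝ) * κ₁ + (a : ℝ) * κ₂ := by nlinarith [mul_pos hb0 hk0, mul_pos ha0 hk20]
  have hsT : (b : ℝ) * κ₁ + (a : ℝ) * κ₂ < (b : ℝ) + (a : ℝ) := by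
    nlinarith [mul_pos hb0 (sub_pos.2 (hkx.trans hx1)), mul_pos ha0 (sub_pos.2 (hk2x.trans hx1))]
  have hbaj : b + a ≤ j'' := by omega
  have hnb : (0:ℝ) < x ^ 2 * (b : ℝ) + (1 - x) * ((b : ℝ) * κ₁ + (a : ℝ) * κ₂) := by nlinarith [mul_pos (pow_pos hx0 2) hb0]
  have hfb : (0:ℝ) < (1 - x) * ((1 + x) * (b : ℝ) - ((b : ℝ) * κ₁ + (a : ℝ) * κ₂)) := by
    apply mul_pos (sub_pos.2 hx1); nlinarith [mul_pos hx0 hb0]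
  have hCb0 : 0 ≤ ((x ^ 2 + (1 - x) * κ₁) * (1 - (x ^ 2 + (1 - x) * κ₂))) * ((1 - x) * ((1 + x) * (b : ℝ) - ((b : ℝ) * κ₁ + (a : ℝ) * κ₂))) / (x ^ 2 * (b : ℝ) + (1 - x) * ((b : ℝ) * κ₁ + (a : ℝ) * κ₂)) := div_nonneg (mul_nonneg (mul_nonneg hu0 (sub_nonneg.2 hv1)) hfb.le) hnb.le
  have hCbspec : ((x ^ 2 + (1 - x) * κ₁) * (1 - (x ^ 2 + (1 - x) * κ₂))) * ((1 - x) * ((1 + x) * (b : ℝ) - ((b : ℝ) * κ₁ + (a : ℝ) * κ₂))) / (x ^ 2 * (b : ℝ) + (1 - x) * ((b : ℝ) * κ₁ + (a : ℝ) * κ₂)) * usage x ((b : ℝ) * κ₁ + (a : ℝ) * κ₂) j'' 0 b ≤ ((x ^ 2 + (1 - x) * κ₁) * (1 - (x ^ 2 + (1 - x) * κ₂))) := le_of_eq (by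
    rw [usage0_eq_light x _ j'' b hx0 hx1 (by omega) hT0 hTb hLb, div_mul_div_comm, div_eq_iff (mul_ne_zero hnb.ne' hfb.ne')]
    ring)
  have hna : (0:ℝ) < x ^ 2 * (a : ℝ) + (1 - x) * ((b : ℝ) * κ₁ + (a : ℝ) * κ₂) := by nlinarith [mul_pos (pow_pos hx0 2) ha0]
  have hfa : (0:ℝ) < (1 - x) * ((1 + x) * (a : ℝ) - ((b : ℝ) * κ₁ + (a : ℝ) * κ₂)) := by
    apply mul_pos (sub_pos.2 hx1); nlinarith [mul_pos hx0 ha0]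
  have hCa0 : 0 ≤ ((1 - (x ^ 2 + (1 - x) * κ₁)) * (x ^ 2 + (1 - x) * κ₂)) * ((1 - x) * ((1 + x) * (a : ℝ) - ((b : ℝ) * κ₁ + (a : ℝ) * κ₂))) / (x ^ 2 * (a : ℝ) + (1 - x) * ((b : ℝ) * κ₁ + (a : ℝ) * κ₂)) := div_nonneg (mul_nonneg (mul_nonneg (sub_nonneg.2 hu1) hv0) hfa.le) hna.le
  have hCaspec : ((1 - (x ^ 2 + (1 - x) * κ₁)) * (x ^ 2 + (1 - x) * κ₂)) * ((1 - x) * ((1 + x) * (a : ℝ) - ((b : ℝ) * κ₁ + (a : ℝ) * κ₂))) / (x ^ 2 * (a : ℝ) + (1 - x) * ((b : ℝ) * κ₁ + (a : ℝ) * κ₂)) * usage x ((b : ℝ) * κ₁ + (a : ℝ) * κ₂) j'' 0 a ≤ ((1 - (x ^ 2 + (1 - x) * κ₁)) * (x ^ 2 + (1 - x) * κ₂)) := le_of_eq (by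
    rw [usage0_eq_light x _ j'' a hx0 hx1 (by omega) hT0 hTa hLa, div_mul_div_comm, div_eq_iff (mul_ne_zero hna.ne' hfa.ne')]
    ring)
  exact twoBlob_decAtT_of_capacity x (x ^ 2 + (1 - x) * κ₁) (x ^ 2 + (1 - x) * κ₂) ((b : ℝ) * κ₁ + (a : ℝ) * κ₂) (((x ^ 2 + (1 - x) * κ₁) * (1 - (x ^ 2 + (1 - x) * κ₂))) * ((1 - x) * ((1 + x) * (b : ℝ) - ((b : ℝ) * κ₁ + (a : ℝ) * κ₂))) / (x ^ 2 * (b : ℝ) + (1 - x) * ((b : ℝ) * κ₁ + (a : ℝ) * κ₂))) (((1 - (x ^ 2 + (1 - x) * κ₁)) * (x ^ 2 + (1 - x) * κ₂)) * ((1 - x) * ((1 + x) * (a : ℝ) - ((b : ℝ) * κ₁ + (a : ℝ) * κ₂))) / (x ^ 2 * (a : ℝ) + (1 - x) * ((b : ℝ) * κ₁ + (a : ℝ) * κ₂))) b a j'' hx0 hx1 hu0 hu1 hv0 hv1 hb ha hbaj hT0 h2b h2a hsT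
    hCb0 hCa0 (Or.inr ⟨hTb, hCbspec⟩) (Or.inr ⟨hTa, hCaspec⟩)
    (cap_O_LL x κ₁ κ₂ a b j'' hx0 hx1 hk0 hkx hk20 hk2x ha hb hj  hTb hLb hTa hLa)

/-- **light–light law, sub-case O** (`T ≤ 2b`, `T ≤ 2a`; `κ`-form): DEC at `T = bκ₁ + aκ₂` by the capacity-proportional flow of
atom `0` (`twoBlob_decAtT_of_capacity`) and the nine capacity cells. [this work] -/
theorem lightLightTwoBlob_decAtT_zeroK (x κ₁ κ₂ : ℝ) (a b j'' : ℕ) (hx0 : 0 < x) (hx1 : x < 1) (hk0 : 0 < κ₁) (hkx : κ₁ < x) (hk20 : 0 < κ₂) (hk2x : κ₂ < x)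
    (ha : 1 ≤ a) (hb : 1 ≤ b) (hj : a + b ≤ j'')
    (h2b : ((b : ℝ) * κ₁ + (a : ℝ) * κ₂) ≤ 2 * (b : ℝ)) (h2a : ((b : ℝ) * κ₁ + (a : ℝ) * κ₂) ≤ 2 * (a : ℝ)) :
    DECAtT x ((b : ℝ) * κ₁ + (a : ℝ) * κ₂) j'' (b + a) (fun h => LAW2[b, (x ^ 2 + (1 - x) * κ₁), a, (x ^ 2 + (1 - x) * κ₂), h]) := by
  rcases lt_or_ge ((b : ℝ) * κ₁ + (a : ℝ) * κ₂) (b : ℝ) with hTb | hTb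
  · rcases le_or_gt ((b : ℝ) * κ₁ + (a : ℝ) * κ₂) (x * (b : ℝ)) with hLb | hHb
    · rcases lt_or_ge ((b : ℝ) * κ₁ + (a : ℝ) * κ₂) (a : ℝ) with hTa | hTa
      · rcases le_or_gt ((b : ℝ) * κ₁ + (a : ℝ) * κ₂) (x * (a : ℝ)) with hLa | hHa
        · exact dec_O_LL x κ₁ κ₂ a b j'' hx0 hx1 hk0 hkx hk20 hk2x ha hb hj h2b h2a hTb hLb hTa hLa
        · exact dec_O_LH x κ₁ κ₂ a b j'' hx0 hx1 hk0 hkx hk20 hk2x ha hb hj h2b h2a hTb hLb hTa hHa.le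
      · exact dec_O_Linc x κ₁ κ₂ a b j'' hx0 hx1 hk0 hkx hk20 hk2x ha hb hj h2b h2a hTb hLb hTa
    · rcases lt_or_ge ((b : ℝ) * κ₁ + (a : ℝ) * κ₂) (a : ℝ) with hTa | hTa
      · rcases le_or_gt ((b : ℝ) * κ₁ + (a : ℝ) * κ₂) (x * (a : ℝ)) with hLa | hHa
        · exact dec_O_HL x κ₁ κ₂ a b j'' hx0 hx1 hk0 hkx hk20 hk2x ha hb hj h2b h2a hTb hHb.le hTa hLa
        · exact dec_O_HH x κ₁ κ₂ a b j'' hx0 hx1 hk0 hkx hk20 hk2x ha hb hj h2b h2a hTb hHb.le hTa hHa.le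
      · exact dec_O_Hinc x κ₁ κ₂ a b j'' hx0 hx1 hk0 hkx hk20 hk2x ha hb hj h2b h2a hTb hHb.le hTa
  · rcases lt_or_ge ((b : ℝ) * κ₁ + (a : ℝ) * κ₂) (a : ℝ) with hTa | hTa
    · rcases le_or_gt ((b : ℝ) * κ₁ + (a : ℝ) * κ₂) (x * (a : ℝ)) with hLa | hHa
      · exact dec_O_incL x κ₁ κ₂ a b j'' hx0 hx1 hk0 hkx hk20 hk2x ha hb hj h2b h2a hTb hTa hLa
      · exact dec_O_incH x κ₁ κ₂ a b j'' hx0 hx1 hk0 hkx hk20 hk2x ha hb hj h2b h2a hTb hTa hHa.le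
    · exact dec_O_incinc x κ₁ κ₂ a b j'' hx0 hx1 hk0 hkx hk20 hk2x ha hb hj h2b h2a hTb hTa

end LawDec

end Quant

end Summit.CriticalPhenomena.PercolationContinuityZ3.Theorems
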